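import Summits.AtomisticToContinuum.HydrodynamicLimit.Theorems.JParityClosureLocalSecondLawLedgerFields
import Mathlib.Analysis.Calculus.ParametricIntegral
import Mathlib.MeasureTheory.Integral.Prod

/-!
# Entropy ledger for `JParityClosure.LocalSecondLaw` — integration by parts for Lipschitz fields on `𝕋³`
(stmt-AtomisticToContinuum-13081, line `exact-entropy-ledger-three-passivities`, layer 4 of stub L)

The crux's partial derivative `∂ₖ f (x₀) = d/dt|₀ f(x₀ + t eₖ)` (junk `0` where the slice is not
differentiable) of a Lipschitz field is bounded by the Lipschitz constant and measurable, and integrates to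
zero over the torus: `t ↦ ∫ f(x + t e) dx` is constant (translation invariance of Haar measure) and may be
differentiated under the integral sign (dominated convergence with the Lipschitz bound; the a.e. derivative
exists by Rademacher).  Consequence: HARDY's weak bond identity
`∫ G (b(xⱼ + v, ·) - b(xⱼ, ·)) = ∫ (∑ₖ vₖ ∂ₖG) b̄`, `b̄(x₀) = ∫₀¹ b(xⱼ + λ v, x₀) dλ`, for every Lipschitz `G` —
the bond function `v b̄` is a vector potential of the difference of the two kernels.

References: R. J. Hardy, *Formulas for determining local properties in molecular-dynamics simulations: shock
waves*, J. Chem. Phys. 76 (1982) 622–628, eqs. (2.8)–(2.12); L. C. Evans, *Partial Differential Equations*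
(2010) App. C.2 (no boundary on the torus).
-/

noncomputable section

namespace Summit.AtomisticToContinuum.HydrodynamicLimit.Theorems.LocalSecondLawLedger

open scoped BigOperators Topology ENNReal InnerProductSpace
open Filter Set MeasureTheory Metric
open Literature.MathematicalPhysics.KineticTheory
open Literature.Analysis.FluidPDE
open Literature.Analysis.FunctionSpaces
open Summit.AtomisticToContinuum.HydrodynamicLimit.Theorems.LocalSecondLawNegative

namespace L

variable {N : ℕ}

/-! ## Smooth test functions are Lipschitz -/

/-- A `C¹` function on `𝕋³` is Lipschitz (bounded derivative of the periodic lift, minimal-image path).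
[folklore] -/
theorem exists_lipschitzWith_of_isContDiff {f : T3 → ℝ} (hf : Torus.IsContDiff 1 f) : ∃ K, LipschitzWith K f := by
  obtain ⟨M, hM⟩ := isCompact_univ.exists_bound_of_continuousOn
    ((Literature.Analysis.FluidPDE.Torus.continuous_fderiv hf).continuousOn (s := Set.univ))
  have hlift : LipschitzWith (Real.toNNReal M) (Torus.lift f) := by
    refine lipschitzWith_of_nnnorm_fderiv_le (hf.differentiable one_ne_zero) fun y => ?_
    rw [Torus.fderiv_lift]
    have h := hM (Torus.proj y) (Set.mem_univ _)
    rw [← NNReal.coe_le_coe, coe_nnnorm]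
    exact h.trans (Real.le_coe_toNNReal M)
  refine ⟨Real.toNNReal M * Real.toNNReal (Real.sqrt 3), LipschitzWith.of_dist_le_mul fun x y => ?_⟩
  have hxy : Torus.proj (Torus.repr y + Torus.reprSym (x - y)) = x := by
    rw [Torus.proj_add, Torus.proj_repr, Torus.proj_reprSym]; abel
  have h1 := hlift.dist_le_mul (Torus.repr y + Torus.reprSym (x - y)) (Torus.repr y)
  rw [Torus.lift_apply, Torus.lift_apply, hxy, Torus.proj_repr, dist_eq_norm (Torus.repr y + _),
    add_sub_cancel_left] at h1
  have h2 : ‖Torus.reprSym (x - y)‖ ≤ Real.sqrt 3 * dist x y := by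
    have := euclidDist_le_sqrt3_mul_dist x y
    rwa [Torus.euclidDist_eq] at this
  calc dist (f x) (f y) ≤ Real.toNNReal M * ‖Torus.reprSym (x - y)‖ := h1
    _ ≤ Real.toNNReal M * (Real.sqrt 3 * dist x y) := mul_le_mul_of_nonneg_left h2 (NNReal.coe_nonneg _)
    _ = (Real.toNNReal M * Real.toNNReal (Real.sqrt 3) : NNReal) * dist x y := by
        rw [NNReal.coe_mul, Real.coe_toNNReal _ (Real.sqrt_nonneg 3)]; ring

/-! ## The crux's partial derivative of a Lipschitz field -/

/-- `∂ₖ f (x₀)` is the derivative at `0` of `t ↦ f (x₀ + t eₖ)` whenever the latter exists. [folklore] -/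
theorem pD_eq_of_hasDerivAt {f : T3 → ℝ} {k : Fin 3} {x : T3} {D : ℝ}
    (h : HasDerivAt (fun t : ℝ => f (x + Torus.proj (t • EuclideanSpace.single k 1))) D 0) : pD k f x = D :=
  h.deriv

/-- The crux's partial derivative of a continuous field is measurable in the field point (Mathlib's
measurability of the derivative with a parameter). [folklore] -/
theorem measurable_pD (k : Fin 3) {f : T3 → ℝ} (hf : Continuous f) : Measurable fun x => pD k f x := by
  have hc : Continuous (Function.uncurry fun (x : T3) (t : ℝ) => f (x + Torus.proj (t • EuclideanSpace.single k 1))) :=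
    hf.comp (continuous_fst.add (Torus.continuous_proj.comp (continuous_snd.smul continuous_const)))
  have hm := measurable_deriv_with_param hc
  exact hm.comp (measurable_id.prodMk measurable_const)

/-- The crux's partial derivative of a Lipschitz field is bounded by the Lipschitz constant (junk value `0`
included). [folklore] -/
theorem abs_pD_le {f : T3 → ℝ} {K : NNReal} (hf : LipschitzWith K f) (k : Fin 3) (x : T3) : |pD k f x| ≤ K := by
  rw [← Real.norm_eq_abs]
  refine norm_deriv_le_of_lip' K.2 (Filter.Eventually.of_forall fun t => ?_)
  have h := hf.dist_le_mul (x + Torus.proj (t • EuclideanSpace.single k 1)) (x + Torus.proj ((0 : ℝ) • EuclideanSpace.single k 1))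
  rw [dist_eq_norm, dist_eq_norm] at h
  refine h.trans (mul_le_mul_of_nonneg_left ?_ K.2)
  rw [zero_smul, Torus.proj_zero, add_zero, add_sub_cancel_left, sub_zero]
  refine (Torus.norm_proj_le _).trans ?_
  simp [norm_smul]


/-- The crux's partial derivative is the line derivative along the coordinate direction. [folklore] -/
theorem pD_eq_lineDeriv (k : Fin 3) (f : T3 → ℝ) (x : T3) :
    pD k f x = Torus.lineDeriv f x (EuclideanSpace.single k 1) := rfl

/-- The line derivative of a continuous field is measurable in the field point. [folklore] -/
theorem measurable_lineDeriv {f : T3 → ℝ} (hf : Continuous f) (e : V3) : Measurable fun x => Torus.lineDeriv f x e := by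
  have hc : Continuous (Function.uncurry fun (x : T3) (t : ℝ) => f (x + Torus.proj (t • e))) :=
    hf.comp (continuous_fst.add (Torus.continuous_proj.comp (continuous_snd.smul continuous_const)))
  exact (measurable_deriv_with_param hc).comp (measurable_id.prodMk measurable_const)

/-- Slices of a Lipschitz field along a line are Lipschitz in the parameter. [folklore] -/
theorem lipschitzWith_slice {f : T3 → ℝ} {K : NNReal} (hf : LipschitzWith K f) (x : T3) (e : V3) :
    LipschitzWith (K * Real.toNNReal ‖e‖) fun t : ℝ => f (x + Torus.proj (t • e)) := by
  refine LipschitzWith.of_dist_le_mul fun t t' => ?_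
  have h := hf.dist_le_mul (x + Torus.proj (t • e)) (x + Torus.proj (t' • e))
  refine h.trans ?_
  rw [NNReal.coe_mul, Real.coe_toNNReal _ (norm_nonneg e), mul_assoc]
  refine mul_le_mul_of_nonneg_left ?_ K.2
  rw [dist_eq_norm, add_sub_add_left_eq_sub, ← Torus.proj_sub, ← sub_smul, Real.dist_eq]
  refine (Torus.norm_proj_le _).trans ?_
  rw [norm_smul, Real.norm_eq_abs, mul_comm]

/-- The line derivative of a Lipschitz field is bounded by the Lipschitz constant times the direction.
[folklore] -/
theorem abs_lineDeriv_le {f : T3 → ℝ} {K : NNReal} (hf : LipschitzWith K f) (x : T3) (e : V3) :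
    |Torus.lineDeriv f x e| ≤ K * ‖e‖ := by
  rw [← Real.norm_eq_abs]
  refine norm_deriv_le_of_lip' (by positivity) (Filter.Eventually.of_forall fun t => ?_)
  have h := (lipschitzWith_slice hf x e).dist_le_mul t 0
  rw [dist_eq_norm, dist_eq_norm, NNReal.coe_mul, Real.coe_toNNReal _ (norm_nonneg e)] at h
  exact h

/-- At a field point where the lift is differentiable, the slice along any direction is differentiable with
derivative the line derivative, which is linear in the direction. [folklore] -/
theorem hasDerivAt_slice_of_differentiableAt {f : T3 → ℝ} {x : T3} (hx : DifferentiableAt ℝ (Torus.liftAt f x) 0)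
    (e : V3) : HasDerivAt (fun t : ℝ => f (x + Torus.proj (t • e))) (Torus.fderiv f x e) 0 := by
  have hL : HasFDerivAt (Torus.liftAt f x) (Torus.fderiv f x) ((0 : ℝ) • e) := by
    rw [zero_smul]; exact hx.hasFDerivAt
  have hc : HasDerivAt (fun t : ℝ => t • e) ((1 : ℝ) • e) 0 := by
    simpa using (hasDerivAt_id (0 : ℝ)).smul_const e
  have h := hL.comp_hasDerivAt (0 : ℝ) hc
  rw [one_smul] at h
  exact h

/-- At a field point where the lift is differentiable the line derivative is linear in the direction:
`∂_v f = ∑ₖ vₖ ∂ₖ f`. [folklore] -/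
theorem lineDeriv_eq_sum_pD {f : T3 → ℝ} {x : T3} (hx : DifferentiableAt ℝ (Torus.liftAt f x) 0) (v : V3) :
    Torus.lineDeriv f x v = ∑ k : Fin 3, v k * pD k f x := by
  have h1 : Torus.lineDeriv f x v = Torus.fderiv f x v := (hasDerivAt_slice_of_differentiableAt hx v).deriv
  have h2 : ∀ k : Fin 3, pD k f x = Torus.fderiv f x (EuclideanSpace.single k 1) := fun k =>
    (hasDerivAt_slice_of_differentiableAt hx _).deriv
  simp only [h1, h2]
  have hv : ∑ k : Fin 3, v k • EuclideanSpace.single k (1 : ℝ) = v := by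
    conv_rhs => rw [← (EuclideanSpace.basisFun (Fin 3) ℝ).sum_repr v]
    simp [EuclideanSpace.basisFun_apply]
  conv_lhs => rw [← hv]
  simp [map_sum, map_smul, smul_eq_mul]

/-! ## `∫ ∂_e f = 0` for Lipschitz `f` -/

/-- **Integration by parts on the torus for Lipschitz fields**: the line derivative of a Lipschitz field has
zero mean (translation invariance of the Haar measure and differentiation under the integral sign, the a.e.
derivative existing by Rademacher's theorem). [folklore] -/
theorem integral_lineDeriv_eq_zero_of_lipschitz {f : T3 → ℝ} {K : NNReal} (hf : LipschitzWith K f) (e : V3) :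
    ∫ x, Torus.lineDeriv f x e = 0 := by
  set Λ : ℝ → ℝ := fun t => ∫ x, f (x + Torus.proj (t • e)) with hΛ
  have hconst : ∀ t, Λ t = ∫ x, f x := fun t => integral_add_right_eq_self f (Torus.proj (t • e))
  have hΛ0 : HasDerivAt Λ 0 0 := by
    have : Λ = fun _ => ∫ x, f x := funext hconst
    rw [this]; exact hasDerivAt_const _ _
  have hcont : Continuous f := hf.continuous
  have hD := hasDerivAt_integral_of_dominated_loc_of_lip (μ := (volume : Measure T3))
    (F := fun (t : ℝ) (x : T3) => f (x + Torus.proj (t • e))) (x₀ := (0 : ℝ)) (s := ball (0 : ℝ) 1)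
    (bound := fun _ => (K : ℝ) * ‖e‖) (F' := fun x => Torus.lineDeriv f x e) (ball_mem_nhds _ one_pos)
    (Filter.Eventually.of_forall fun t =>
      (hcont.comp (continuous_id.add continuous_const)).aestronglyMeasurable)
    (by simpa using integrable_of_continuous_T3 hcont)
    (measurable_lineDeriv hcont e).aestronglyMeasurable
    (Filter.Eventually.of_forall fun x => by
      have h := (lipschitzWith_slice hf x e).lipschitzOnWith (s := ball (0 : ℝ) 1)
      convert h using 2
      ext
      simp)
    (integrable_const _)
    (by
      filter_upwards [Torus.ae_differentiableAt_liftAt hf] with x hx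
      exact (hasDerivAt_slice_of_differentiableAt hx e).differentiableAt.hasDerivAt)
  exact (hD.2.unique hΛ0)

/-- The crux's partial derivatives of a Lipschitz field have zero mean. [folklore] -/
theorem integral_pD_eq_zero_of_lipschitz {f : T3 → ℝ} {K : NNReal} (hf : LipschitzWith K f) (k : Fin 3) :
    ∫ x, pD k f x = 0 :=
  integral_lineDeriv_eq_zero_of_lipschitz hf _

/-! ## Hardy's weak bond identity -/

/-- The kernel of a displaced particle is jointly continuous in displacement and field point. [folklore] -/
theorem continuous_cone_displaced {r : ℝ} (hr : 0 < r) (xj : T3) (v : V3) :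
    Continuous fun p : ℝ × T3 => cone r (xj + Torus.proj (p.1 • v)) p.2 := by
  have : (fun p : ℝ × T3 => cone r (xj + Torus.proj (p.1 • v)) p.2) =
      fun p => cone r (xj + Torus.proj (p.1 • v) - p.2) 0 := funext fun p => cone_eq_sub _ _ _
  rw [this]
  exact (lipschitzWith_cone_zero hr).continuous.comp
    ((continuous_const.add (Torus.continuous_proj.comp (continuous_fst.smul continuous_const))).sub
      continuous_snd)

section Hardy

variable {G : T3 → ℝ} {K : NNReal} (hG : LipschitzWith K G) {r : ℝ} (hr : 0 < r)
include hG hr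

/-- Integrating a Lipschitz weight against the field derivative of the kernel is integrating its line
derivative against the kernel: `∫ G (-∂ᵥb(y,·)) = ∫ (∂ᵥG) b(y,·)` (integration by parts, layer lemma
`integral_lineDeriv_eq_zero_of_lipschitz` for the Lipschitz product `G b(y, ·)`). [folklore] -/
theorem integral_mul_neg_cg (y : T3) (v : V3) :
    ∫ x, G x * (-cg r y x v) = ∫ x, Torus.lineDeriv G x v * cone r y x := by
  have hGc : Continuous G := hG.continuous
  obtain ⟨A, hA⟩ := exists_abs_le_of_lipschitzWith hG
  have hprod : LipschitzWith _ fun x => G x * cone r y x :=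
    lipschitzWith_mul_bounded hG (lipschitzWith_cone_right hr _) hA (abs_cone_le hr _)
  have h0 := integral_lineDeriv_eq_zero_of_lipschitz hprod v
  have hae : ∀ᵐ x : T3, Torus.lineDeriv (fun x => G x * cone r y x) x v =
      Torus.lineDeriv G x v * cone r y x + G x * cg r y x v := by
    filter_upwards [Torus.ae_differentiableAt_liftAt hG,
      Torus.ae_differentiableAt_liftAt_sub (lipschitzWith_cone_zero hr) y] with x h1 h2
    have hG' := hasDerivAt_slice_of_differentiableAt h1 v
    have hb' := hasDerivAt_cone_field h2 v
    rw [Torus.lineDeriv, (hG'.fun_mul hb').deriv, Torus.lineDeriv, hG'.deriv]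
    simp [cg]
  rw [integral_congr_ae hae, integral_add] at h0
  · simp only [mul_neg, integral_neg]
    linarith
  · exact Integrable.mono' (integrable_const ((K : ℝ) * ‖v‖ * (3 / (Real.pi * r ^ 3))))
      (((measurable_lineDeriv hGc v).mul (continuous_cone r _).measurable).aestronglyMeasurable)
      (Filter.Eventually.of_forall fun x => by
        rw [Real.norm_eq_abs, abs_mul]
        exact mul_le_mul (abs_lineDeriv_le hG x v) (abs_cone_le hr _ _) (abs_nonneg _) (by positivity))
  · exact Integrable.mono' (integrable_const (A * (coneLip r * ‖v‖)))
      ((hGc.measurable.mul (measurable_cg r _ v)).aestronglyMeasurable)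
      (Filter.Eventually.of_forall fun x => by
        rw [Real.norm_eq_abs, abs_mul]
        exact mul_le_mul (hA x) (abs_cg_le hr _ _ _) (abs_nonneg _) ((abs_nonneg _).trans (hA x)))

/-- The bond curve `λ ↦ ∫ G b(xⱼ + λ v, ·)` is differentiable, with derivative `∫ G (-∂ᵥ b(xⱼ + λv, ·))`
(differentiation under the integral sign; the kernel of the displaced particle is differentiable in the
displacement at almost every field point). [folklore] -/
theorem hasDerivAt_bondCurve (xj : T3) (v : V3) (l : ℝ) :
    HasDerivAt (fun l : ℝ => ∫ x, G x * cone r (xj + Torus.proj (l • v)) x)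
      (∫ x, G x * (-cg r (xj + Torus.proj (l • v)) x v)) l := by
  have hGc : Continuous G := hG.continuous
  obtain ⟨A, hA⟩ := exists_abs_le_of_lipschitzWith hG
  have hAx : 0 ≤ A := (abs_nonneg _).trans (hA 0)
  have h_lip : ∀ x : T3, LipschitzOnWith (Real.nnabs (A * (coneLip r * ‖v‖)))
      (fun t : ℝ => G x * cone r (xj + Torus.proj (t • v)) x) (ball l 1) := by
    intro x
    refine LipschitzOnWith.of_dist_le_mul fun t _ t' _ => ?_
    rw [Real.dist_eq, ← mul_sub, abs_mul]
    have hb := (lipschitzWith_cone_left hr x).dist_le_mul (xj + Torus.proj (t • v)) (xj + Torus.proj (t' • v))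
    rw [Real.dist_eq, dist_eq_norm, add_sub_add_left_eq_sub, ← Torus.proj_sub, ← sub_smul] at hb
    have hb' : |cone r (xj + Torus.proj (t • v)) x - cone r (xj + Torus.proj (t' • v)) x| ≤
        coneLip r * ‖v‖ * |t - t'| := by
      refine hb.trans ?_
      calc (coneLip r : ℝ) * ‖Torus.proj ((t - t') • v)‖ ≤ coneLip r * ‖(t - t') • v‖ :=
            mul_le_mul_of_nonneg_left (Torus.norm_proj_le _) (coneLip r).2
        _ = coneLip r * ‖v‖ * |t - t'| := by rw [norm_smul, Real.norm_eq_abs]; ring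
    calc |G x| * |cone r (xj + Torus.proj (t • v)) x - cone r (xj + Torus.proj (t' • v)) x|
        ≤ A * (coneLip r * ‖v‖ * |t - t'|) := mul_le_mul (hA x) hb' (abs_nonneg _) hAx
      _ = ↑(Real.nnabs (A * (coneLip r * ‖v‖))) * dist t t' := by
          rw [Real.dist_eq, Real.coe_nnabs, abs_of_nonneg (mul_nonneg hAx (by positivity))]; ring
  have h_diff : ∀ᵐ x : T3, HasDerivAt (fun t : ℝ => G x * cone r (xj + Torus.proj (t • v)) x)
      (G x * (-cg r (xj + Torus.proj (l • v)) x v)) l := by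
    filter_upwards [Torus.ae_differentiableAt_liftAt_sub (lipschitzWith_cone_zero hr) (xj + Torus.proj (l • v))]
      with x hx
    have h := (hasDerivAt_cone_flight hx v).const_mul (G x)
    have h' : HasDerivAt (fun t : ℝ => G x * cone r (xj + Torus.proj (l • v) + Torus.proj (t • v)) x)
        (G x * -cg r (xj + Torus.proj (l • v)) x v) (l - l) := by
      rw [sub_self]; simpa [cg] using h
    refine (h'.comp_sub_const l l).congr_of_eventuallyEq (Filter.Eventually.of_forall fun t => ?_)
    show G x * cone r (xj + Torus.proj (t • v)) x = G x * cone r (xj + Torus.proj (l • v) + Torus.proj ((t - l) • v)) x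
    rw [add_assoc, ← Torus.proj_add, ← add_smul, add_sub_cancel]
  exact (hasDerivAt_integral_of_dominated_loc_of_lip (ball_mem_nhds _ one_pos)
    (Filter.Eventually.of_forall fun t => (hGc.mul (continuous_cone r _)).aestronglyMeasurable)
    (integrable_of_continuous_T3 (hGc.mul (continuous_cone r _)))
    ((hGc.measurable.mul (measurable_cg r _ v).neg).aestronglyMeasurable)
    (Filter.Eventually.of_forall h_lip) (integrable_const _) h_diff).2

/-- `λ ↦ ∫ (∂ᵥG) b(xⱼ + λv, ·)` is continuous (dominated convergence). [folklore] -/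
theorem continuous_integral_lineDeriv_mul_cone (xj : T3) (v : V3) :
    Continuous fun l : ℝ => ∫ x, Torus.lineDeriv G x v * cone r (xj + Torus.proj (l • v)) x := by
  have hGc : Continuous G := hG.continuous
  have hF : ∀ l : ℝ, Measurable fun x : T3 => cone r (xj + Torus.proj (l • v)) x := fun l =>
    (continuous_cone r (xj + Torus.proj (l • v))).measurable
  have hmeas : ∀ l : ℝ, AEStronglyMeasurable
      (fun x : T3 => Torus.lineDeriv G x v * cone r (xj + Torus.proj (l • v)) x) volume := fun l =>
    ((measurable_lineDeriv hGc v).mul (hF l)).aestronglyMeasurable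
  have hbound : ∀ l : ℝ, ∀ᵐ x : T3, ‖Torus.lineDeriv G x v * cone r (xj + Torus.proj (l • v)) x‖ ≤
      (K : ℝ) * ‖v‖ * (3 / (Real.pi * r ^ 3)) := by
    intro l
    refine Filter.Eventually.of_forall fun x => ?_
    rw [Real.norm_eq_abs, abs_mul]
    exact mul_le_mul (abs_lineDeriv_le hG x v) (abs_cone_le hr _ _) (abs_nonneg _) (by positivity)
  have hint : Integrable (fun _ : T3 => (K : ℝ) * ‖v‖ * (3 / (Real.pi * r ^ 3))) (volume : Measure T3) :=
    integrable_const _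
  have hcx : ∀ x : T3, Continuous fun l : ℝ => cone r (xj + Torus.proj (l • v)) x := fun x =>
    (lipschitzWith_cone_left hr x).continuous.comp
      (continuous_const.add (Torus.continuous_proj.comp (continuous_id.smul continuous_const)))
  have hcont : ∀ᵐ x : T3, Continuous fun l : ℝ => Torus.lineDeriv G x v * cone r (xj + Torus.proj (l • v)) x :=
    Filter.Eventually.of_forall fun x => continuous_const.mul (hcx x)
  exact continuous_of_dominated hmeas hbound hint hcont

/-- **Hardy's weak bond identity.** For a Lipschitz weight `G`, a base point `xⱼ` and a displacement `v`,
`∫ G(x) (b_r(xⱼ + v, x) - b_r(xⱼ, x)) dx = ∫ (∑ₖ vₖ ∂ₖG(x)) (∫₀¹ b_r(xⱼ + λ v, x) dλ) dx`: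
the bond average `v b̄` of the kernel along the segment is a vector potential for the difference of the
end-point kernels (Hardy 1982, eqs. (2.8)–(2.12)).  Proof: the bond curve `Λ(λ) = ∫ G b_r(xⱼ + λv, ·)` is `C¹`
with `Λ' = ∫ (∂ᵥ G) b_r(xⱼ + λ v, ·)`, then the fundamental theorem of calculus and Fubini.
[cite: Hardy1982, eqs. (2.8)–(2.12)] -/
theorem hardy_bond (xj : T3) (v : V3) :
    ∫ x, G x * (cone r (xj + Torus.proj v) x - cone r xj x) =
      ∫ x, (∑ k : Fin 3, v k * pD k G x) * ∫ l in Set.Icc (0 : ℝ) 1, cone r (xj + Torus.proj (l • v)) x := by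
  have hGc : Continuous G := hG.continuous
  set Λ' : ℝ → ℝ := fun l => ∫ x, Torus.lineDeriv G x v * cone r (xj + Torus.proj (l • v)) x with hΛ'
  have hderiv : ∀ l, HasDerivAt (fun l : ℝ => ∫ x, G x * cone r (xj + Torus.proj (l • v)) x) (Λ' l) l := fun l => by
    have h := hasDerivAt_bondCurve hG hr xj v l
    rwa [integral_mul_neg_cg hG hr] at h
  have hFTC := intervalIntegral.integral_eq_sub_of_hasDerivAt (fun l _ => hderiv l)
    ((continuous_integral_lineDeriv_mul_cone hG hr xj v).intervalIntegrable 0 1)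
  have hL : ∫ x, G x * (cone r (xj + Torus.proj v) x - cone r xj x) =
      (∫ x, G x * cone r (xj + Torus.proj ((1 : ℝ) • v)) x) - ∫ x, G x * cone r (xj + Torus.proj ((0 : ℝ) • v)) x := by
    simp only [one_smul, zero_smul, Torus.proj_zero, add_zero, mul_sub]
    exact integral_sub (integrable_of_continuous_T3 (hGc.mul (continuous_cone r _)))
      (integrable_of_continuous_T3 (hGc.mul (continuous_cone r _)))
  rw [hL, ← hFTC, intervalIntegral.integral_of_le zero_le_one, ← integral_Icc_eq_integral_Ioc]
  have hswap : ∫ l in Set.Icc (0 : ℝ) 1, Λ' l =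
      ∫ x, ∫ l in Set.Icc (0 : ℝ) 1, Torus.lineDeriv G x v * cone r (xj + Torus.proj (l • v)) x := by
    refine integral_integral_swap ?_
    refine Integrable.mono' (integrable_const ((K : ℝ) * ‖v‖ * (3 / (Real.pi * r ^ 3)))) ?_ ?_
    · exact (((measurable_lineDeriv hGc v).comp measurable_snd).mul
        (continuous_cone_displaced hr xj v).measurable).aestronglyMeasurable
    · exact Filter.Eventually.of_forall fun p => by
        rw [Function.uncurry_def, Real.norm_eq_abs, abs_mul]
        exact mul_le_mul (abs_lineDeriv_le hG p.2 v) (abs_cone_le hr _ _) (abs_nonneg _) (by positivity)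
  rw [hswap]
  refine integral_congr_ae ?_
  filter_upwards [Torus.ae_differentiableAt_liftAt hG] with x hx
  rw [integral_const_mul, lineDeriv_eq_sum_pD hx]

end Hardy

/-! ## Bounded measurable integrands on the torus -/

/-- A continuous real function on `𝕋³` is bounded. [folklore] -/
theorem exists_abs_le_of_continuous {f : T3 → ℝ} (hf : Continuous f) : ∃ A, ∀ x, |f x| ≤ A := by
  obtain ⟨A, hA⟩ := isCompact_univ.exists_bound_of_continuousOn (hf.continuousOn (s := Set.univ))
  exact ⟨A, fun x => by simpa [Real.norm_eq_abs] using hA x (Set.mem_univ x)⟩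

/-- A bounded (a.e. strongly) measurable real function on `𝕋³` is integrable. [folklore] -/
theorem integrable_of_abs_le {f : T3 → ℝ} (hm : AEStronglyMeasurable f volume) {C : ℝ} (h : ∀ x, |f x| ≤ C) :
    Integrable f := Integrable.mono' (integrable_const C) hm (Filter.Eventually.of_forall fun x => by
      rw [Real.norm_eq_abs]; exact h x)

/-- Product of a continuous function with a bounded measurable one is integrable on `𝕋³`. [folklore] -/
theorem integrable_continuous_mul {f h : T3 → ℝ} (hf : Continuous f) (hh : Measurable h) {C : ℝ}
    (hC : ∀ x, |h x| ≤ C) : Integrable fun x => f x * h x := by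
  obtain ⟨A, hA⟩ := exists_abs_le_of_continuous hf
  refine integrable_of_abs_le (hf.measurable.mul hh).aestronglyMeasurable (C := A * C) fun x => ?_
  rw [abs_mul]
  exact mul_le_mul (hA x) (hC x) (abs_nonneg _) ((abs_nonneg _).trans (hA x))


end L

/-- **Registered sub-goal `ledgerL_ibp`** of stub `stub_ledger` (line `exact-entropy-ledger-three-passivities`):
Integration by parts on the torus for Lipschitz fields: the crux's partial derivatives have zero mean. [folklore] -/
theorem ledgerL_ibp :
  ∀ {f : T3 → ℝ} {K : NNReal}, LipschitzWith K f → ∀ k : Fin 3, ∫ x, pD k f x = 0 :=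
  fun hf k => L.integral_pD_eq_zero_of_lipschitz hf k

end Summit.AtomisticToContinuum.HydrodynamicLimit.Theorems.LocalSecondLawLedger

end
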